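import Literature.MathematicalPhysics.QuantumFieldTheory.Balaban1983to89.B7Ineq200General

/-!
# `Balaban1983to89.B7Prop10Printed204` — T. Bałaban, *Averaging operations for lattice gauge theories*, Commun. Math. Phys. **98**
(1985) 17–51 [Balaban1985Averaging], Sect. F, **Proposition 10 p. 50 with (204)/(206) IN THE PRINTED SHAPE «|ũ′ʲ(y) − 1| <
α₄ + 2C′₅α₄Lη + … + 2C′₅α₄Lʲη» AT A GENERAL BACKGROUND — NO α₀-TERM IN (204), the SAME right-hand side `B7Prop10Flat.rhs204` as at the
flat background**, over the concrete `ℤᵈ` carrier of the `B7Prop9General`/`B7Prop10General` lineage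

statement-level skeleton of published theorems with citation tags; proofs where landed; nothing here is a claim about the Yang–Mills mass gap

PDF held: `paper:balaban1985-cmp98-averaging` (journal page = PDF page + 16); pp. 49–50 read on the renders
`b2b-balaban-ref1/pages/1985-cmp98-averaging/1985-cmp98-averaging-p033-x2.png`, `…-p034-x2.png` (AS IMAGES, this unit, 2026-08-21).

CITATION HEADER (lean-in-tree rule).  Cell `lit-balaban` (HOME `run/shared/lean/pub/lit-balaban/`), unit `lit-balaban-r04` (B7 block
owner, gen 5) — KERNEL PIECE for SKELETON rows **`B7.Prop10`** and `B7.Eq201` ((201)–(206)); companion of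
`B7Prop10General.prop10_general` (whose (204)-half carries the `α₀`-increments `8dC′₅C₆L²α₀α₄(Lⁱη)²` of `B7Prop9General.eq200_general`,
`rhs204G`) and of `B7Ineq200General.eq200_printed` (this unit: the one-step (200) WITHOUT `α₀`).

PRINT (p. 49, verbatim).  «Let us denote `β = α₀α₄ + α₃α₄ + α₄²`, `C₅ = 1 + 4C′₅`, `C₄ = 8C′₄C₅`. We will prove by induction that
`|(ũ′ʲ)⁻¹(c₋)R̄ʲ_{0,c}ũ′ʲ(c₊) − 1| < α₄Lʲη + C₄β(Lʲη)²`, `c ⊂ Ω^{(j)}`, (203) `|ũ′ʲ(y) − 1| < α₄ + 2C′₅α₄Lη + … + 2C′₅α₄Lʲη`, `y ∈ Ω^{(j)}`.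
(204) … We apply Proposition 9 with `V₀ = Ū₀ʲ, v′ = ũ′ʲ, v₁ = \overline{R₀u₁}ʲ`. We have `α₀` replaced by `2α₀(Lʲη)²`, `α′₃` replaced by
`α₃Lʲη`, `α₄` replaced by the right-hand side of (204), which can be bounded by `α₄(1 + 4C′₅) = C₅α₄`, and `α′₄` replaced by the
right-hand side of (203), which can be bounded by `2α₄`. … `|ũ′^{j+1}(y) − 1| < α₄ + 2C′₅α₄Lη + … + 2C′₅α₄Lʲη + 2C′₅α₄L^{j+1}η`. (206)»
(p. 50) «**Proposition 10.** There exist positive constants `C₄, C₅, c₆` such that for arbitrary configurations `U₀, u′, u₁` satisfying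
(52), (176), (177), (166), (167) with `α₀, α₃, α₄ ≦ c₆` the bounds (203), (204) hold for `j ≦ k`. This result implies in particular that
the configuration `u′` belongs to the class `Λ_k(C₅α₄)`.»

WHAT THIS FILE PROVES (kernel, no `sorry`, standard axioms; theorems only).  **`prop10_general_printed204`**: under EXACTLY the
hypotheses of `B7Prop10General.prop10_general` (level backgrounds `Ū₀ʲ`, `j < k`, in `U1` with «`α₀` replaced by `2α₀(Lʲη)²`»,
(176) `SiteBd u′ α₄`, (177) `CovBondBd U₀ u′ (α₄η)`, `u₁ ∈ Λ_k(U₀, α₃)`, `L ≥ 2`, `0 ≤ η`, `Lᵏη ≤ 1`, the displayed smallness), for every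
`j ≤ k`: (203) `CovBondBd (Ū₀ʲ) (ũ′ʲ) (α₄Lʲη + C₄β(Lʲη)²)` as there (`rhs203G`, `C₄ = C4G d L`) AND **(204) `SiteBd (ũ′ʲ) (α₄ +
2C′₅α₄(Lη + … + Lʲη))` = `B7Prop10Flat.rhs204 d L j α₄ η`, `C′₅ = 64(d+1)` — print's (204) verbatim, the same right-hand side as at the
flat background, no `α₀`-term.**  The induction is print's, with the (204)-step now fed by `B7Ineq200General.eq200_printed` (one step:
`α₄ ↦ (204)ⱼ + 6d·L·(203)ⱼ ≤ (204)ⱼ + 12dα₄L^{j+1}η ≤ (204)ⱼ + 2C′₅α₄L^{j+1}η = (204)ⱼ₊₁`, i.e. (206)) and the (203)-step by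
`B7Prop9General.prop9_general` + `B7Prop10General.ineq205G` as before (with `T = (204)ⱼ ≤ C₅α₄ ≤ C₆α₄`, `B7Prop10Flat.rhs204_le`).
`prop10_general_printed204'` (closed forms: (203) `≤ 2α₄Lʲη`, (204) `≤ C₅α₄`, **`C₅ = 1 + 4C′₅` verbatim**), `prop10_printed204_of52` (level
hypotheses discharged by Proposition 2, `B7Prop10General.levels_of52`).
READINGS (recorded).  (a) as in `B7Prop10General` for (203) (`C₄ = C₄(d, L)`: the `α₀α₄`-term of `B7Prop9General.eq199_general` keeps its
extra power of `L`); (b) (204): shape AS PRINTED with `C′₅ = 64(d+1)` (any `C′₅ ≥ 6d` works by `eq200_printed`); (c) the smallness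
hypotheses are those of `prop10_general` unchanged (`hs₆` is still consumed by the (203)-step `ineq205G`).
REUSED BY NAME: `B7Prop10General.{utilG, utilG_zero, utilG_succ, rhs203G, rhs203G_zero, rhs203G_le, C4G, C6, ineq205G, covBondBd_mono,
levels_of52}`, `B7Prop10Flat.{rhs204, rhs204_zero, rhs204_succ, rhs204_le, C5, one_le_C5, C5'_nonneg, C4'_nonneg, siteBd_mono}`,
`B7Prop9General.prop9_general`, `B7Ineq200General.eq200_printed`, `B7Prop8Flat.pow_eta_le`, `B7Eq167Flat.InLambda`.
Unit `lit-balaban-r04` (gen 5), 2026-08-21.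

[cite: Balaban1985Averaging, Proposition 10 p.50, (201)–(206) p.49, Proposition 9 (199)–(200) p.49, (176)–(179) p.45, (166)–(167) p.44]
-/

noncomputable section

open scoped BigOperators
open NormedSpace Finset

namespace Literature.MathematicalPhysics.QuantumFieldTheory.Balaban1983to89.B7Prop10Printed204

open B7Prop1Explicit B7Prop2Explicit MatrixLog B7Eq92Concrete B7Eq99Concrete B7Eq84Concrete B7Eq167Flat B7Prop8Flat
  B7Prop9Flat B7Prop9General B7Prop10General B7Ineq200General
open B7Prop10Flat (rhs204 rhs204_zero rhs204_succ rhs204_le C5 one_le_C5 C5'_nonneg C4'_nonneg siteBd_mono)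

-- `Site` alone would resolve to the torus sites of `Setup.lean`; re-export the `ℤ^d` sites of `B7Prop1Explicit`.
export B7Prop1Explicit (Site)

variable {d : ℕ}

variable {𝔸 : Type*} [NormedRing 𝔸] [NormOneClass 𝔸] [NormedAlgebra ℂ 𝔸] [CompleteSpace 𝔸]

omit [NormOneClass 𝔸] [NormedAlgebra ℂ 𝔸] [CompleteSpace 𝔸] in
/-- `C₅ ≤ C₆` and `2 ≤ C₆` (`C₆ = C₅ + 1`). [folklore] -/
private theorem C5_le_C6 : C5 d ≤ C6 d ∧ (2 : ℝ) ≤ C6 d := by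
  unfold C6; constructor <;> linarith [one_le_C5 (d := d)]

/-- **PROPOSITION 10 AT A GENERAL BACKGROUND WITH (204) AS PRINTED** (p. 49 (203)–(204), p. 50 Proposition 10): under the hypotheses of
`B7Prop10General.prop10_general`, for every `j ≤ k`, (203) `‖ũ′ʲ(c₋)⁻¹R̄ʲ_{0,c}ũ′ʲ(c₊) − 1‖ ≤ α₄Lʲη + C₄β(Lʲη)²` (`rhs203G`, `C₄ = C4G d L`,
`β = α₀α₄ + α₃α₄ + α₄²`) and **(204) `‖ũ′ʲ(y) − 1‖ ≤ α₄ + 2C′₅α₄Lη + … + 2C′₅α₄Lʲη`** (`B7Prop10Flat.rhs204 d L j α₄ η`, `C′₅ = 64(d+1)`;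
NO `α₀`-term), `ũ′ʲ = utilG L U₀ u′ u₁ j`.  Print's induction: the (203)-step is `B7Prop9General.prop9_general` at `V₀ = Ū₀ʲ` closed by
`ineq205G`, the (204)-step is the `α₀`-free one-step (200) `B7Ineq200General.eq200_printed` closed by (206):
`(204)ⱼ + 6dL·(203)ⱼ ≤ (204)ⱼ + 2C′₅α₄L^{j+1}η`. [cite: Balaban1985Averaging, Proposition 10 p.50, (203)–(206) p.49] -/
theorem prop10_general_printed204 {L : ℕ} (hL : 2 ≤ L) {U₀ : Site d → Fin d → 𝔸ˣ} {k : ℕ} {u' u₁ : Site d → 𝔸ˣ}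
    {α₀ α₃ α₄ η : ℝ}
    (hV : ∀ j < k, ∀ (x : Site d) (κ : Fin d), avgIter L U₀ j x κ ∈ U1 𝔸)
    (h52 : ∀ j < k, ∀ (x : Site d) (κ μ : Fin d), κ ≠ μ →
      ‖((hol (avgIter L U₀ j) x (plaqWord κ μ) : 𝔸ˣ) : 𝔸) - 1‖ ≤ 2 * α₀ * ((L : ℝ) ^ j * η) ^ 2)
    (h176 : SiteBd u' α₄) (h177 : CovBondBd U₀ u' (α₄ * η)) (hu₁ : InLambda L U₀ u₁ k α₃ η)
    (hη : 0 ≤ η) (hk : (L : ℝ) ^ k * η ≤ 1) (hα₀ : 0 ≤ α₀) (hα₃ : 0 ≤ α₃) (hα₃' : α₃ ≤ 1 / 50) (hα₄ : 0 ≤ α₄)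
    (hs₁ : 10 * C6 d * α₄ ≤ 1) (hs₂ : 3000 * ((d : ℝ) + 1) * L * α₄ ≤ 1) (hs₃ : C4G d L * (α₀ + α₃ + α₄) ≤ 1)
    (hs₄ : 1024 * ((d : ℝ) + 1) * ((d : ℝ) + 4) * L ^ 2 * α₀ ≤ 1) (hs₅ : 32 * ((d : ℝ) + 1) ^ 2 * C6 d * L ^ 2 * α₀ ≤ 1)
    (hs₆ : 16 * d * C5' d * C6 d * (L : ℝ) ^ 2 * α₀ ≤ 1) :
    ∀ j ≤ k, CovBondBd (avgIter L U₀ j) (utilG L U₀ u' u₁ j) (rhs203G d L j α₀ α₃ α₄ η) ∧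
      SiteBd (utilG L U₀ u' u₁ j) (rhs204 d L j α₄ η) := by
  obtain ⟨hC56, hC6⟩ := C5_le_C6 (d := d)
  have h5' := C5'_nonneg (d := d)
  have h4' := C4'_nonneg (d := d)
  have hL1 : 1 ≤ L := le_trans (by norm_num) hL
  have hLr : (2 : ℝ) ≤ L := by exact_mod_cast hL
  have hd : (0 : ℝ) ≤ d := Nat.cast_nonneg d
  have hC4G : 0 ≤ C4G d L := by
    have h7 : (0 : ℝ) ≤ C7 d := by unfold C7; linarith
    unfold C4G; positivity
  have h167 : ∀ j < k, ∀ (z : Site d) (r : Fin d → Fin L),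
      ‖((((uavg L U₀ u₁ j ((L : ℤ) • z))⁻¹ *
          R0fun (avgIter L U₀ j) ((L : ℤ) • z) (uavg L U₀ u₁ j) ((L : ℤ) • z + boxVec L r) : 𝔸ˣ)) : 𝔸) - 1‖
        ≤ α₃ * (L : ℝ) ^ (j + 1) * η := by
    have h := hu₁.2
    simp only [Cond167, R0fun_add] at h ⊢
    exact h
  intro j hj
  induction j with
  | zero =>
    refine ⟨?_, ?_⟩
    · rw [utilG_zero, avgIter_zero, rhs203G_zero]
      refine covBondBd_mono h177 ?_
      have : 0 ≤ C4G d L * (α₀ * α₄ + α₃ * α₄ + α₄ ^ 2) * η ^ 2 := by positivity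
      linarith
    · rw [utilG_zero, rhs204_zero]; exact h176
  | succ j ih =>
    have hjk : j < k := hj
    obtain ⟨hB, hS⟩ := ih hjk.le
    -- the scale parameter `t = Lʲη ≤ 1`, and `L t ≤ 1`
    have ht := (pow_eta_le hL1 hη hk hjk.le).1
    have hLt : (L : ℝ) ^ (j + 1) * η ≤ 1 := (pow_eta_le hL1 hη hk (Nat.succ_le_of_lt hjk)).1
    have hLt' : (L : ℝ) * ((L : ℝ) ^ j * η) ≤ 1 := by rw [← mul_assoc, ← pow_succ']; exact hLt
    have ht0 : 0 ≤ (L : ℝ) ^ j * η := by positivity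
    set t := (L : ℝ) ^ j * η with ht_def
    have hA := rhs203G_le (d := d) hα₄ hη ht hs₃
    have hA0 : 0 ≤ rhs203G d L j α₀ α₃ α₄ η := by unfold rhs203G; positivity
    -- `T = (204)ⱼ ≤ C₅α₄ ≤ C₆α₄`
    have hT5 : rhs204 d L j α₄ η ≤ C5 d * α₄ := rhs204_le (d := d) hL hα₄ hη ht
    have hT : rhs204 d L j α₄ η ≤ C6 d * α₄ := hT5.trans (mul_le_mul_of_nonneg_right hC56 hα₄)
    have hT0 : 0 ≤ rhs204 d L j α₄ η := (norm_nonneg _).trans (hS 0)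
    -- level-`j` data
    set V : Site d → Fin d → 𝔸ˣ := avgIter L U₀ j with hVdef
    set α₀j : ℝ := 2 * α₀ * t ^ 2 with hα₀j
    have hα₀j0 : 0 ≤ α₀j := by positivity
    have hVU : ∀ x κ, V x κ ∈ U1 𝔸 := hV j hjk
    have h44 : ∀ (x : Site d) (κ μ : Fin d), κ ≠ μ → ‖((hol V x (plaqWord κ μ) : 𝔸ˣ) : 𝔸) - 1‖ ≤ α₀j :=
      fun x κ μ hκμ => h52 j hjk x κ μ hκμ
    -- hypotheses (180) of Proposition 9 at step `j`
    have h3c : SiteBd (uavg L U₀ u₁ j) α₃ := fun z => hu₁.1 j hjk.le z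
    have h3d : CovBlockBd L V (uavg L U₀ u₁ j) (L * (α₃ * t)) := by
      intro z r
      have := h167 j hjk z r
      calc _ ≤ α₃ * (L : ℝ) ^ (j + 1) * η := this
        _ = L * (α₃ * t) := by rw [ht_def]; ring
    have hq : 50 * (L * (α₃ * t)) ≤ 1 := by
      have e : L * (α₃ * t) = α₃ * (L * t) := by ring
      have h1 : α₃ * (L * t) ≤ α₃ * 1 := mul_le_mul_of_nonneg_left hLt' hα₃
      rw [e]; linarith
    have hα₄j : rhs204 d L j α₄ η ≤ 1 / 10 := hT.trans (by linarith)
    -- the smallness of Proposition 9 at step `j`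
    have ht2 : t ^ 2 ≤ t := by nlinarith
    have hg : 16 * ((d : ℝ) + 1) ^ 2 * L ^ 2 * α₀j * rhs204 d L j α₄ η ≤ α₄ * t := by
      have e : 16 * ((d : ℝ) + 1) ^ 2 * L ^ 2 * α₀j * rhs204 d L j α₄ η =
          (32 * ((d : ℝ) + 1) ^ 2 * L ^ 2 * α₀) * t ^ 2 * rhs204 d L j α₄ η := by rw [hα₀j]; ring
      have h1 : (32 * ((d : ℝ) + 1) ^ 2 * L ^ 2 * α₀) * t ^ 2 * rhs204 d L j α₄ η ≤
          (32 * ((d : ℝ) + 1) ^ 2 * L ^ 2 * α₀) * t ^ 2 * (C6 d * α₄) :=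
        mul_le_mul_of_nonneg_left hT (by positivity)
      have h2 : (32 * ((d : ℝ) + 1) ^ 2 * L ^ 2 * α₀) * t ^ 2 * (C6 d * α₄) =
          (32 * ((d : ℝ) + 1) ^ 2 * C6 d * L ^ 2 * α₀) * (t ^ 2 * α₄) := by ring
      have h3 : (32 * ((d : ℝ) + 1) ^ 2 * C6 d * L ^ 2 * α₀) * (t ^ 2 * α₄) ≤ 1 * (t ^ 2 * α₄) :=
        mul_le_mul_of_nonneg_right hs₅ (by positivity)
      have h4 : t ^ 2 * α₄ ≤ t * α₄ := mul_le_mul_of_nonneg_right ht2 hα₄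
      rw [e]; linarith
    have hs : 1000 * ((d : ℝ) + 1) * L *
        (rhs203G d L j α₀ α₃ α₄ η + 16 * ((d : ℝ) + 1) ^ 2 * L ^ 2 * α₀j * rhs204 d L j α₄ η) ≤ 1 := by
      have h1 : rhs203G d L j α₀ α₃ α₄ η + 16 * ((d : ℝ) + 1) ^ 2 * L ^ 2 * α₀j * rhs204 d L j α₄ η ≤ 3 * α₄ * t := by
        linarith
      have h0 : 0 ≤ 1000 * ((d : ℝ) + 1) * L := by positivity
      have h2 := mul_le_mul_of_nonneg_left h1 h0
      have h3 : 1000 * ((d : ℝ) + 1) * L * (3 * α₄ * t) = 3000 * ((d : ℝ) + 1) * L * α₄ * t := by ring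
      have h4 : 3000 * ((d : ℝ) + 1) * L * α₄ * t ≤ 3000 * ((d : ℝ) + 1) * L * α₄ * 1 := by
        have : 0 ≤ 3000 * ((d : ℝ) + 1) * L * α₄ := by positivity
        exact mul_le_mul_of_nonneg_left ht this
      linarith
    have hα₀s : 512 * ((d : ℝ) + 1) * ((d : ℝ) + 4) * L ^ 2 * α₀j ≤ 1 := by
      have : 512 * ((d : ℝ) + 1) * ((d : ℝ) + 4) * L ^ 2 * α₀j =
          1024 * ((d : ℝ) + 1) * ((d : ℝ) + 4) * L ^ 2 * α₀ * t ^ 2 := by rw [hα₀j]; ring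
      rw [this]
      have h0 : 0 ≤ 1024 * ((d : ℝ) + 1) * ((d : ℝ) + 4) * (L : ℝ) ^ 2 * α₀ := by positivity
      linarith [mul_le_mul_of_nonneg_left (ht2.trans ht) h0]
    -- (203)-step: Proposition 9 at step `j` (as in `prop10_general`)
    have h9 := prop9_general hL1 hVU hα₀j0 h44 hS hB h3c h3d hα₄j hA0 (hα₃'.trans (by norm_num)) hq hs hα₀s
    have eV : rescale L (bavg L V) = avgIter L U₀ (j + 1) := by rw [hVdef, avgIter_succ]
    have eU : (fun z => vtilG L V (utilG L U₀ u' u₁ j) (uavg L U₀ u₁ j) ((L : ℤ) • z)) = utilG L U₀ u' u₁ (j + 1) := by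
      rw [utilG_succ]
    rw [eV, eU] at h9
    -- (204)-step: the α₀-free one-step (200) `B7Ineq200General.eq200_printed` at step `j`
    have hs200 : 100 * ((d : ℝ) * L * rhs203G d L j α₀ α₃ α₄ η) ≤ 1 := by
      have hdLa : 0 ≤ (d : ℝ) * L * α₄ := by positivity
      have hLa : 0 ≤ (L : ℝ) * α₄ := by positivity
      have h1 : (d : ℝ) * L * rhs203G d L j α₀ α₃ α₄ η ≤ (d : ℝ) * L * (2 * α₄ * t) :=
        mul_le_mul_of_nonneg_left hA (by positivity)
      have h2 : (d : ℝ) * L * (2 * α₄ * t) ≤ (d : ℝ) * L * (2 * α₄ * 1) :=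
        mul_le_mul_of_nonneg_left (mul_le_mul_of_nonneg_left ht (by positivity)) (by positivity)
      have e1 : (d : ℝ) * L * (2 * α₄ * 1) = 2 * ((d : ℝ) * L * α₄) := by ring
      have e2 : 3000 * ((d : ℝ) + 1) * L * α₄ = 3000 * ((d : ℝ) * L * α₄) + 3000 * ((L : ℝ) * α₄) := by ring
      linarith
    have h200 := siteBd_vtilG_printed hL1 hVU hS hB h3c h3d (hα₄j.trans (by norm_num)) hA0 hα₃'
      (by linarith : L * (α₃ * t) ≤ 1 / 50) hs200
    rw [eU] at h200
    refine ⟨covBondBd_mono h9.1 ?_, siteBd_mono h200 ?_⟩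
    · -- (205)
      have := ineq205G (d := d) hL hα₀ hα₃ hα₄ hη ht hLt hs₃ hs₅ hs₆ hA0 le_rfl hT0 hT
      rw [hα₀j]
      exact this
    · -- (206): `(204)ⱼ + 6dL·(203)ⱼ ≤ (204)ⱼ + 12dα₄L^{j+1}η ≤ (204)ⱼ + 2C′₅α₄L^{j+1}η = (204)ⱼ₊₁`
      rw [rhs204_succ]
      have h1 : 6 * (d : ℝ) * L * rhs203G d L j α₀ α₃ α₄ η ≤ 6 * d * L * (2 * α₄ * t) :=
        mul_le_mul_of_nonneg_left hA (by positivity)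
      have h2 : 6 * (d : ℝ) * L * (2 * α₄ * t) = 12 * d * α₄ * ((L : ℝ) ^ (j + 1) * η) := by rw [ht_def]; ring
      have h3 : 12 * (d : ℝ) * α₄ * ((L : ℝ) ^ (j + 1) * η) ≤ 2 * C5' d * α₄ * ((L : ℝ) ^ (j + 1) * η) := by
        have hc : 12 * (d : ℝ) ≤ 2 * C5' d := by unfold C5'; linarith
        have h0 : 0 ≤ α₄ * ((L : ℝ) ^ (j + 1) * η) := by positivity
        calc 12 * (d : ℝ) * α₄ * ((L : ℝ) ^ (j + 1) * η) = (12 * (d : ℝ)) * (α₄ * ((L : ℝ) ^ (j + 1) * η)) := by ring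
          _ ≤ (2 * C5' d) * (α₄ * ((L : ℝ) ^ (j + 1) * η)) := mul_le_mul_of_nonneg_right hc h0
          _ = 2 * C5' d * α₄ * ((L : ℝ) ^ (j + 1) * η) := by ring
      linarith

/-- **Proposition 10 with (204) as printed, closed forms** (p. 49: the right-hand side of (203) «can be bounded by `2α₄`», that of (204)
«by `α₄(1 + 4C′₅) = C₅α₄`» — HERE WITH PRINT'S `C₅ = 1 + 4C′₅` VERBATIM, `B7Prop10Flat.C5`): under the hypotheses of
`prop10_general_printed204`, for all `j ≤ k`, `‖ũ′ʲ(c₋)⁻¹R̄ʲ_{0,c}ũ′ʲ(c₊) − 1‖ ≤ 2α₄Lʲη` and `‖ũ′ʲ − 1‖ ≤ C₅α₄`; in particular (p. 50)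
«`u′` belongs to the class `Λ_k(C₅α₄)`» for its (166)-half. [cite: Balaban1985Averaging, Proposition 10 p.50, (203)–(204) p.49] -/
theorem prop10_general_printed204' {L : ℕ} (hL : 2 ≤ L) {U₀ : Site d → Fin d → 𝔸ˣ} {k : ℕ} {u' u₁ : Site d → 𝔸ˣ}
    {α₀ α₃ α₄ η : ℝ}
    (hV : ∀ j < k, ∀ (x : Site d) (κ : Fin d), avgIter L U₀ j x κ ∈ U1 𝔸)
    (h52 : ∀ j < k, ∀ (x : Site d) (κ μ : Fin d), κ ≠ μ →
      ‖((hol (avgIter L U₀ j) x (plaqWord κ μ) : 𝔸ˣ) : 𝔸) - 1‖ ≤ 2 * α₀ * ((L : ℝ) ^ j * η) ^ 2)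
    (h176 : SiteBd u' α₄) (h177 : CovBondBd U₀ u' (α₄ * η)) (hu₁ : InLambda L U₀ u₁ k α₃ η)
    (hη : 0 ≤ η) (hk : (L : ℝ) ^ k * η ≤ 1) (hα₀ : 0 ≤ α₀) (hα₃ : 0 ≤ α₃) (hα₃' : α₃ ≤ 1 / 50) (hα₄ : 0 ≤ α₄)
    (hs₁ : 10 * C6 d * α₄ ≤ 1) (hs₂ : 3000 * ((d : ℝ) + 1) * L * α₄ ≤ 1) (hs₃ : C4G d L * (α₀ + α₃ + α₄) ≤ 1)
    (hs₄ : 1024 * ((d : ℝ) + 1) * ((d : ℝ) + 4) * L ^ 2 * α₀ ≤ 1) (hs₅ : 32 * ((d : ℝ) + 1) ^ 2 * C6 d * L ^ 2 * α₀ ≤ 1)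
    (hs₆ : 16 * d * C5' d * C6 d * (L : ℝ) ^ 2 * α₀ ≤ 1) :
    ∀ j ≤ k, CovBondBd (avgIter L U₀ j) (utilG L U₀ u' u₁ j) (2 * α₄ * ((L : ℝ) ^ j * η)) ∧
      SiteBd (utilG L U₀ u' u₁ j) (C5 d * α₄) := by
  intro j hj
  have hL1 : 1 ≤ L := le_trans (by norm_num) hL
  have ht := (pow_eta_le hL1 hη hk hj).1
  obtain ⟨hB, hS⟩ := prop10_general_printed204 hL hV h52 h176 h177 hu₁ hη hk hα₀ hα₃ hα₃' hα₄ hs₁ hs₂ hs₃ hs₄ hs₅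
    hs₆ j hj
  exact ⟨covBondBd_mono hB (rhs203G_le hα₄ hη ht hs₃), siteBd_mono hS (rhs204_le hL hα₄ hη ht)⟩

/-- **Proposition 10 with (204) as printed, under (52)** — the level hypotheses discharged by Proposition 2
(`B7Prop10General.levels_of52`): for `U₀` with values in an average-closed subgroup `G ⊂ U1` (e.g. `unitaryUnits 𝔸`) satisfying (52)
`sup_p‖U₀(∂p) − 1‖ < α₀η²`, `η = L^{−k}`, and `u′, u₁` with (176), (177), (166)–(167): for all `j ≤ k`, (203) `≤ 2α₄Lʲη` and (204)
`‖ũ′ʲ − 1‖ ≤ C₅α₄`, `C₅ = 1 + 4C′₅`. [cite: Balaban1985Averaging, Proposition 10 p.50, Proposition 2 p.26, (203)–(204) p.49] -/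
theorem prop10_printed204_of52 {L : ℕ} (hL : 2 ≤ L) {G : Subgroup 𝔸ˣ} (hG : AvgClosed d L G) {U₀ : Site d → Fin d → 𝔸ˣ}
    (hU : ∀ x κ, U₀ x κ ∈ G) {k : ℕ} {u' u₁ : Site d → 𝔸ˣ} {α₀ α₃ α₄ : ℝ}
    (hα : 0 < α₀) (hα3 : C0 d * α₀ ≤ 1 / 3) (hα2 : 2 * α₀ ≤ c2' d L)
    (h52 : pdev U₀ < α₀ * (((L : ℝ) ^ k)⁻¹) ^ 2)
    (h176 : SiteBd u' α₄) (h177 : CovBondBd U₀ u' (α₄ * ((L : ℝ) ^ k)⁻¹))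
    (hu₁ : InLambda L U₀ u₁ k α₃ (((L : ℝ) ^ k)⁻¹))
    (hα₃ : 0 ≤ α₃) (hα₃' : α₃ ≤ 1 / 50) (hα₄ : 0 ≤ α₄)
    (hs₁ : 10 * C6 d * α₄ ≤ 1) (hs₂ : 3000 * ((d : ℝ) + 1) * L * α₄ ≤ 1) (hs₃ : C4G d L * (α₀ + α₃ + α₄) ≤ 1)
    (hs₄ : 1024 * ((d : ℝ) + 1) * ((d : ℝ) + 4) * L ^ 2 * α₀ ≤ 1) (hs₅ : 32 * ((d : ℝ) + 1) ^ 2 * C6 d * L ^ 2 * α₀ ≤ 1)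
    (hs₆ : 16 * d * C5' d * C6 d * (L : ℝ) ^ 2 * α₀ ≤ 1) :
    ∀ j ≤ k, CovBondBd (avgIter L U₀ j) (utilG L U₀ u' u₁ j) (2 * α₄ * ((L : ℝ) ^ j * ((L : ℝ) ^ k)⁻¹)) ∧
      SiteBd (utilG L U₀ u' u₁ j) (C5 d * α₄) := by
  obtain ⟨hV, hP⟩ := levels_of52 hL hG hU k hα hα3 hα2 h52
  have hη : (0 : ℝ) ≤ ((L : ℝ) ^ k)⁻¹ := by positivity
  have hk : (L : ℝ) ^ k * ((L : ℝ) ^ k)⁻¹ ≤ 1 := by rw [mul_inv_cancel₀ (by positivity)]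
  exact prop10_general_printed204' hL (fun j hj => hV j hj.le) (fun j hj => hP j hj.le) h176 h177 hu₁ hη hk hα.le hα₃ hα₃'
    hα₄ hs₁ hs₂ hs₃ hs₄ hs₅ hs₆

end Literature.MathematicalPhysics.QuantumFieldTheory.Balaban1983to89.B7Prop10Printed204

end
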